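import Summits.CriticalPhenomena.SAWScalingLimit.Theses.SAWDevelopingMap
import Summits.CriticalPhenomena.SAWScalingLimit.Theses.SAWPhaseRetrieval
import Summits.CriticalPhenomena.SAWScalingLimit.Theses.SAWCompassLattice
import Summits.CriticalPhenomena.SAWScalingLimit.Theorems.SAWDevelopingMapHexTransferCompassRealisation
import Summits.CriticalPhenomena.SAWScalingLimit.Theorems.SAWDevelopingMapHexTransferCompassEndpoints
import Summits.CriticalPhenomena.SAWScalingLimit.Theorems.SAWDevelopingMapHexTransferPortDictionary
import Summits.CriticalPhenomena.SAWScalingLimit.Theorems.SAWDevelopingMapHexTransferPortTransfer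

/-!
# Line `Sketch` (quarter-turn pinning) for the crux `HexTransfer` — the reduction that is left

Crux `stmt-CriticalPhenomena-14221`:
`HexTransfer := (Duminil-Copin–Smirnov 2012 Conjecture 1, written out) → SAWScalingLimit`
(`Theses.SAWPhaseRetrieval.HexTransfer`, identical bodies in `SAWDevelopingMap`, `SAWWindingAlias`,
`SAWDefectDecoherence`).

The line routes the hexagonal hypothesis through Glazman–Manolescu's critical Yang–Baxter walk on the
square tiling (Θ ≡ π/2) and the honest compass self-avoiding walk of route `SAWCompassLattice`. Four of
its six registered stubs are theorems of the tree (this session):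

* `stub_compassRealisation : CompassRealisation` (`…HexTransferCompassRealisation.lean`),
* `stub_compassEndpoints : CompassEndpoints` (`…HexTransferCompassEndpoints.lean`),
* `stub_portDictionary : PortDictionary` (`…HexTransferPortDictionary.lean` and parts),
* `stub_portTransfer : PortDictionary → YBSquareSLE → CompassSLE` (`…HexTransferPortTransfer.lean` and parts).

What remains are two statements of open-problem size, kept here as HYPOTHESES (nothing is assumed
about the crux itself): the Θ-transport `HexConjecture → YBSquareSLE` (law-level transport of chordal
SLE(8/3) convergence inside the Yang–Baxter family, π/3 ↦ π/2) and `SurfaceUniversality` (item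
stmt-CriticalPhenomena-6964: compass ↔ uniform ℤ², the D4-internal universality step). This file records,
sorry-free, that they suffice (`stub_lineReduction`), and the by-product for route `SAWCompassLattice`:
its conjunct now follows from `YBSquareSLE` and `SurfaceUniversality` alone
(`sawScalingLimit_of_ybSquareSLE_of_surfaceUniversality`).
-/

namespace Summit.CriticalPhenomena.SAWScalingLimit.Cruxes.HexTransfer.Sketch

open Summit.CriticalPhenomena.SAWScalingLimit.Theses

/-- **Route `SAWCompassLattice` minus its landed supports.** Chordal SLE(8/3) convergence of
Glazman–Manolescu's critical Yang–Baxter walk on the square tiling (`YBSquareSLE`, stmt-6967) and the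
compass ↔ uniform-ℤ² universality step (`SurfaceUniversality`, stmt-6964) imply the sub-problem
statement `SAWScalingLimit`: `CompassRealisation`, `CompassEndpoints`, `PortDictionary` and the port
transfer `PortDictionary → YBSquareSLE → CompassSLE` are theorems, and `SAWCompassLattice.closes`
assembles. [folklore] -/
theorem sawScalingLimit_of_ybSquareSLE_of_surfaceUniversality
    (hYB : SAWCompassLattice.YBSquareSLE) (hU : SAWCompassLattice.SurfaceUniversality) :
    _root_.SAWScalingLimit :=
  SAWCompassLattice.closes stub_compassRealisation stub_compassEndpoints
    (stub_portTransfer stub_portDictionary hYB) hU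

/-- **What the line `Sketch` leaves of the crux `HexTransfer` (stmt-CriticalPhenomena-14221).** If
Duminil-Copin–Smirnov's Conjecture 1 on the hexagonal lattice transports to the square Yang–Baxter
tiling (`HexConjecture → YBSquareSLE`, the line's stub `stub_thetaTransport`) and the compass/ℤ²
surface-universality step holds (`SurfaceUniversality`, the line's stub `stub_surfaceUniversality`),
then `HexTransfer`. The hexagonal hypothesis of the crux is consumed exactly once, by the transport.
[folklore] -/
theorem stub_lineReduction :
    (SAWDevelopingMap.HexConjecture → SAWCompassLattice.YBSquareSLE) →
      SAWCompassLattice.SurfaceUniversality → SAWPhaseRetrieval.HexTransfer :=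
  fun hΘ hU hHex => sawScalingLimit_of_ybSquareSLE_of_surfaceUniversality (hΘ hHex) hU

end Summit.CriticalPhenomena.SAWScalingLimit.Cruxes.HexTransfer.Sketch
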